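import Mathlib
import HarnessLib
import Summits.AnomalousDissipation.AnomalousDissipation.Theses.PointSink

/-!
# Line `suction-feeder` — crux stmt-AnomalousDissipation-19034 (`PointSink.ConeDesingularisation`)
# STRATEGIST alternative line (planner-cstrat-stmt-AnomalousDissipation-19034-s1-0, 2026-08-17)

WHY A NEW LINE. The route cone changed: `PointSink.PointFluxCone` (stmt-19033) is now a THEOREM
(`Theorems.PointFluxCone_of`, dilation-periodised pressureless wild box). By its author's own caveat the
witness carries NO energy flux between shells (the typed "flux log-mean ≠ 0" is a bulk-roughness moment
`⟨D, log|x|⟩` of a SIGNED Duchon–Robert defect inside each box copy, net zero per shell) and its Bernoulli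
head `½|W|² + P = e/6 + π` is POSITIVE on the boxes. Consequences for this crux:

* as typed, `ConeDesingularisation = (PointFluxCone → CascadeSoliton)` is now EQUIVALENT to the support
  node `CascadeSoliton` (stmt-19036): the hypothesis is discharged and carries no information;
* the live skeleton (line `Sketch`, v5 by the continuation lead) has already drawn the consequence: its only open stub is
  now `stub_cascadeSolitonCore` = the node itself with the far field UNPINNED (v4's `stub_core` pinned the far field to
  the given cone, which for positive-head cones such as the wild box is refutable in principle — necessity of suction,
  `Ideas/no-positive-head-feeding.md`); the lead reports "no line can reduce it further";
* the physical thesis of the route (an Euler cone feeding a viscous point sink by a genuine inward energy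
  flux) needs an ADMISSIBLE feeder: a DSS weak Euler cone that (i) is locally `L³`/`L^{3/2}` so that energy
  fluxes are classical, (ii) satisfies the LOCAL ENERGY BALANCE off the origin (no Duchon–Robert defect on
  `ℝ³ ∖ {0}`: then the shell log-moment IS `Π log λ`, `Π` the flux through every sphere), (iii) is a
  SUCTION cone (`½|V|² + P ≤ 0` a.e. — the viscosity-admissibility sign forced by the head maximum
  principle `Δ(½|Q|²+P) − Q·∇(½|Q|²+P) = |curl Q|² ≥ 0` of steady NS and the decay of D-solutions), with
  bounded head on the fundamental shell (2001 T3 admissibility; the bounded factor that transfers the cubic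
  flux under shell-`L²` convergence), and (iv) has INWARD flux `Π < 0`.

THE LINE = the honest re-erection of the route's Euler gate + the desingularisation with a contentful
hypothesis (two registered stubs, both genuine; composition is modus ponens because the crux's own
hypothesis is now vacuous-in-effect):

* `stub_suctionFeederCone` (XL; Euler side; killable): a suction feeder cone exists. Stationary,
  Onsager-critical, sign-constrained: below `C^{1/2}` (non-renormalised head, landed D1
  `Theorems.stub_dssFluxRigidity`) yet defect-free off the tip (heuristically `≥ C^{1/3}`, CET) — the
  window `1/3 ≤ α < 1/2`. Stationary convex integration reaches only `L^∞` (Choffrut–Székelyhidi 2014,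
  p. 3: the Hölder schemes "do not apply to the stationary case"), so this is open; its refutation
  ("suction + defect-free + DSS(−2/3) ⇒ fluxless") would kill the whole PointSink line honestly (k1).
* `stub_fedDesingularisation` (open-problem class; NS side): a suction feeder cone ⇒ a cascade soliton
  (conclusion = `CascadeSoliton` verbatim, far field NOT pinned to the given cone — the lesson of
  `stub_core`). What the hypothesis buys: the non-triviality FLOOR of every exhaustion/blow-down scheme
  becomes the identity `D(Q) = |Π|` (flux transfer with bounded head under shell-`L²` convergence, card
  `suction-head` K2) instead of "Liouville in disguise"; the head ceiling is one-sided a-priori control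
  (card `suction-head` K1); the remaining core is SELECTION of the admissible cone by steady vanishing
  viscosity along `ν_k = λ^{-k/3}` (cards `blowdown-zeroth-law` K1, `abc-window-selection`).

Composition `ConeDesingularisation_of` discards the (now proved) hypothesis `PointFluxCone` and applies
`stub_fedDesingularisation` to `stub_suctionFeederCone`. Sanity theorem `suctionFeederCone_pointFluxCone`
(proved): the feeder class REFINES the typed cone class, so the line is a strengthening of the route's
intended chain, not a detour. Same two statements are filed as the route-level SPLIT of the crux
(children `SuctionFeederCone`, `FedDesingularisation`; glue `Theorems.coneDesingularisation_of_subs`).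

Disproof used (Cruxes/ConeDesingularisation/Disproof.lean, cdisprove cycle 1): honours §3
`coneDesingularisation_iff_not_cone_of_liouville` — every proof of the crux refutes Liouville for steady
D-solutions; this line does not pretend otherwise: `stub_fedDesingularisation` IS an anti-Liouville
construction, but one fed by an admissible object with an exact energy identity. Honours §2 (no finite
energy, envelope exponent pinned at 5/3: conclusion verbatim) and §2c (`L^p`-escape: no criterion through
`Q ∈ L^p`, `p ≤ 9/2`, bites). No landed Negative lemma concerns feeder cones.
-/

noncomputable section

-- `Summit.<Summit>.<Problem>`: single-conjunct summit, the duplicate namespace is mandated (CONVENTIONS §2).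
set_option linter.dupNamespace false

open MeasureTheory Filter Topology Set
open Literature.Analysis.FunctionSpaces Literature.Analysis.FluidPDE

namespace Summit.AnomalousDissipation.AnomalousDissipation.Cruxes.ConeDesingularisation.SuctionFeeder

/-! ## Registered stubs (notation-free signatures, verbatim the split children of the route) -/

/-- **Stub 1 — `stub_suctionFeederCone` (XL; Euler side; the killable gate).** A SUCTION FEEDER CONE
exists: `λ > 1`, a velocity `V` and a pressure `P` on `ℝ³ ∖ {0}`, DSS of degrees `(−2/3, −4/3)` under
`x ↦ λx`, `|V|², P, |V|³, |P|^{3/2}` locally integrable off the origin, weak stationary Euler and weakly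
divergence free off the origin (the clauses of `PointFluxCone` verbatim), satisfying the LOCAL ENERGY
BALANCE off the origin `∫ (½|V|²+P) ⟪V, ∇η⟫ = 0` for every test `η` supported off `0`, with SUCTION head
`½|V|² + P ≤ 0` a.e., head bounded below on the fundamental shell, integrable radial flux density there
and NEGATIVE (inward) flux log-mean `∫_{1<|x|<λ} (½|V|²+P)⟪V,x⟫/|x|² < 0` (`= Π log λ`). -/
theorem stub_suctionFeederCone :
    ∃ (lam : ℝ) (V : EuclideanSpace ℝ (Fin 3) → EuclideanSpace ℝ (Fin 3)) (P : EuclideanSpace ℝ (Fin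
      3) → ℝ), 1 < lam ∧ MeasureTheory.AEStronglyMeasurable V MeasureTheory.volume ∧ (∀ x :
      EuclideanSpace ℝ (Fin 3), x ≠ 0 → V (lam • x) = lam ^ (-(2 / 3 : ℝ)) • V x) ∧ (∀ x :
      EuclideanSpace ℝ (Fin 3), x ≠ 0 → P (lam • x) = lam ^ (-(4 / 3 : ℝ)) * P x) ∧
      MeasureTheory.LocallyIntegrableOn (fun x => ‖V x‖ ^ 2) {x : EuclideanSpace ℝ (Fin 3) | x ≠ 0}
      MeasureTheory.volume ∧ MeasureTheory.LocallyIntegrableOn P {x : EuclideanSpace ℝ (Fin 3) | x ≠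
      0} MeasureTheory.volume ∧ MeasureTheory.LocallyIntegrableOn (fun x => ‖V x‖ ^ 3) {x :
      EuclideanSpace ℝ (Fin 3) | x ≠ 0} MeasureTheory.volume ∧ MeasureTheory.LocallyIntegrableOn
      (fun x => |P x| ^ (3 / 2 : ℝ)) {x : EuclideanSpace ℝ (Fin 3) | x ≠ 0} MeasureTheory.volume ∧
      (∀ φ : EuclideanSpace ℝ (Fin 3) → EuclideanSpace ℝ (Fin 3),
      Literature.Analysis.FunctionSpaces.IsTestFunctionOn ⟨{x : EuclideanSpace ℝ (Fin 3) | x ≠ 0},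
      isOpen_ne⟩ φ → ∫ x, (inner ℝ (V x) (fderiv ℝ φ x (V x)) + P x *
      Literature.Analysis.FluidPDE.VectorCalculus.divergence φ x) = 0) ∧ (∀ θ : EuclideanSpace ℝ
      (Fin 3) → ℝ, Literature.Analysis.FunctionSpaces.IsTestFunctionOn ⟨{x : EuclideanSpace ℝ (Fin
      3) | x ≠ 0}, isOpen_ne⟩ θ → ∫ x, inner ℝ (V x) (gradient θ x) = 0) ∧ (∀ η : EuclideanSpace ℝ
      (Fin 3) → ℝ, Literature.Analysis.FunctionSpaces.IsTestFunctionOn ⟨{x : EuclideanSpace ℝ (Fin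
      3) | x ≠ 0}, isOpen_ne⟩ η → ∫ x, (‖V x‖ ^ 2 / 2 + P x) * inner ℝ (V x) (gradient η x) = 0) ∧
      (∀ᵐ x ∂MeasureTheory.volume, ‖V x‖ ^ 2 / 2 + P x ≤ 0) ∧ (∃ M : ℝ, ∀ᵐ x
      ∂(MeasureTheory.volume.restrict {x : EuclideanSpace ℝ (Fin 3) | 1 < ‖x‖ ∧ ‖x‖ < lam}), -M ≤ ‖V
      x‖ ^ 2 / 2 + P x) ∧ MeasureTheory.IntegrableOn (fun x => (‖V x‖ ^ 2 / 2 + P x) * (inner ℝ (V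
      x) x / ‖x‖ ^ 2)) {x : EuclideanSpace ℝ (Fin 3) | 1 < ‖x‖ ∧ ‖x‖ < lam} MeasureTheory.volume ∧
      (∫ x in {x : EuclideanSpace ℝ (Fin 3) | 1 < ‖x‖ ∧ ‖x‖ < lam}, (‖V x‖ ^ 2 / 2 + P x) * (inner ℝ
      (V x) x / ‖x‖ ^ 2)) < 0 := by
  sorry

/-- **Stub 2 — `stub_fedDesingularisation` (open-problem class; NS side; HARDEST).** FED
DESINGULARISATION: if a suction feeder cone exists then a CASCADE SOLITON exists — the conclusion is the
route's support node `PointSink.CascadeSoliton` verbatim (smooth steady unforced NS₁ on `ℝ³`, `L²`-mass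
envelope `R^{5/3}`, `0 < ∫|∇Q|² < ∞`, non-trivial (−2/3)-DSS shell-`L²` far field), the far field NOT
pinned to the given cone. Intended mechanism: blow-down / stirred approximants at `ν_k = λ^{-k/3}`
(existence free), head ceiling off the stirring (maximum principle), floor `D = |Π|` by flux transfer with
the cone's bounded suction head, Morrey-envelope compactness; the open core is the steady
vanishing-viscosity SELECTION of the admissible cone. Why it might fail: consensus expects Liouville for
all steady D-solutions (then this stub is `¬ stub 1`); steady branches may laminarise or detach from the
cone at the `L³` level. -/
theorem stub_fedDesingularisation :
    (∃ (lam : ℝ) (V : EuclideanSpace ℝ (Fin 3) → EuclideanSpace ℝ (Fin 3)) (P : EuclideanSpace ℝ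
      (Fin 3) → ℝ), 1 < lam ∧ MeasureTheory.AEStronglyMeasurable V MeasureTheory.volume ∧ (∀ x :
      EuclideanSpace ℝ (Fin 3), x ≠ 0 → V (lam • x) = lam ^ (-(2 / 3 : ℝ)) • V x) ∧ (∀ x :
      EuclideanSpace ℝ (Fin 3), x ≠ 0 → P (lam • x) = lam ^ (-(4 / 3 : ℝ)) * P x) ∧
      MeasureTheory.LocallyIntegrableOn (fun x => ‖V x‖ ^ 2) {x : EuclideanSpace ℝ (Fin 3) | x ≠ 0}
      MeasureTheory.volume ∧ MeasureTheory.LocallyIntegrableOn P {x : EuclideanSpace ℝ (Fin 3) | x ≠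
      0} MeasureTheory.volume ∧ MeasureTheory.LocallyIntegrableOn (fun x => ‖V x‖ ^ 3) {x :
      EuclideanSpace ℝ (Fin 3) | x ≠ 0} MeasureTheory.volume ∧ MeasureTheory.LocallyIntegrableOn
      (fun x => |P x| ^ (3 / 2 : ℝ)) {x : EuclideanSpace ℝ (Fin 3) | x ≠ 0} MeasureTheory.volume ∧
      (∀ φ : EuclideanSpace ℝ (Fin 3) → EuclideanSpace ℝ (Fin 3),
      Literature.Analysis.FunctionSpaces.IsTestFunctionOn ⟨{x : EuclideanSpace ℝ (Fin 3) | x ≠ 0},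
      isOpen_ne⟩ φ → ∫ x, (inner ℝ (V x) (fderiv ℝ φ x (V x)) + P x *
      Literature.Analysis.FluidPDE.VectorCalculus.divergence φ x) = 0) ∧ (∀ θ : EuclideanSpace ℝ
      (Fin 3) → ℝ, Literature.Analysis.FunctionSpaces.IsTestFunctionOn ⟨{x : EuclideanSpace ℝ (Fin
      3) | x ≠ 0}, isOpen_ne⟩ θ → ∫ x, inner ℝ (V x) (gradient θ x) = 0) ∧ (∀ η : EuclideanSpace ℝ
      (Fin 3) → ℝ, Literature.Analysis.FunctionSpaces.IsTestFunctionOn ⟨{x : EuclideanSpace ℝ (Fin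
      3) | x ≠ 0}, isOpen_ne⟩ η → ∫ x, (‖V x‖ ^ 2 / 2 + P x) * inner ℝ (V x) (gradient η x) = 0) ∧
      (∀ᵐ x ∂MeasureTheory.volume, ‖V x‖ ^ 2 / 2 + P x ≤ 0) ∧ (∃ M : ℝ, ∀ᵐ x
      ∂(MeasureTheory.volume.restrict {x : EuclideanSpace ℝ (Fin 3) | 1 < ‖x‖ ∧ ‖x‖ < lam}), -M ≤ ‖V
      x‖ ^ 2 / 2 + P x) ∧ MeasureTheory.IntegrableOn (fun x => (‖V x‖ ^ 2 / 2 + P x) * (inner ℝ (V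
      x) x / ‖x‖ ^ 2)) {x : EuclideanSpace ℝ (Fin 3) | 1 < ‖x‖ ∧ ‖x‖ < lam} MeasureTheory.volume ∧
      (∫ x in {x : EuclideanSpace ℝ (Fin 3) | 1 < ‖x‖ ∧ ‖x‖ < lam}, (‖V x‖ ^ 2 / 2 + P x) * (inner ℝ
      (V x) x / ‖x‖ ^ 2)) < 0) → ∃ (Q : EuclideanSpace ℝ (Fin 3) → EuclideanSpace ℝ (Fin 3)) (P :
      EuclideanSpace ℝ (Fin 3) → ℝ), Literature.Analysis.FluidPDE.IsClassicalNSSolutionOn Set.univ 1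
      (fun _ _ => 0) (fun _ => Q) (fun _ => P) ∧ (∃ C : ℝ, ∀ R : ℝ, 1 ≤ R → ∫ x in Metric.ball (0 :
      EuclideanSpace ℝ (Fin 3)) R, ‖Q x‖ ^ 2 ≤ C * R ^ (5 / 3 : ℝ)) ∧ MeasureTheory.Integrable (fun
      x => Literature.Analysis.FluidPDE.frobeniusNormSq (fderiv ℝ Q x)) ∧ 0 < ∫ x,
      Literature.Analysis.FluidPDE.frobeniusNormSq (fderiv ℝ Q x) ∧ ∃ (lam : ℝ) (V : EuclideanSpace
      ℝ (Fin 3) → EuclideanSpace ℝ (Fin 3)), 1 < lam ∧ MeasureTheory.AEStronglyMeasurable V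
      MeasureTheory.volume ∧ (∀ x : EuclideanSpace ℝ (Fin 3), x ≠ 0 → V (lam • x) = lam ^ (-(2 / 3 :
      ℝ)) • V x) ∧ MeasureTheory.LocallyIntegrableOn (fun x => ‖V x‖ ^ 2) {x : EuclideanSpace ℝ (Fin
      3) | x ≠ 0} MeasureTheory.volume ∧ 0 < ∫ x in {x : EuclideanSpace ℝ (Fin 3) | 1 < ‖x‖ ∧ ‖x‖ <
      lam}, ‖V x‖ ^ 2 ∧ Filter.Tendsto (fun k : ℕ => (lam ^ k) ^ (-(5 / 3 : ℝ)) * ∫ x in {x :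
      EuclideanSpace ℝ (Fin 3) | lam ^ k < ‖x‖ ∧ ‖x‖ < lam ^ (k + 1)}, ‖Q x - V x‖ ^ 2) Filter.atTop
      (nhds 0) := by
  sorry

/-! ## Sanity: the feeder class refines the typed (closed) cone class -/

/-- A suction feeder cone is in particular a point-flux cone in the sense of the (now closed) rank-2 crux
`PointSink.PointFluxCone`: drop the extra clauses and weaken `< 0` to `≠ 0`. So the line STRENGTHENS the
route's intended chain `cone → soliton`; it does not change its shape. -/
theorem suctionFeederCone_pointFluxCone
    (h : ∃ (lam : ℝ) (V : EuclideanSpace ℝ (Fin 3) → EuclideanSpace ℝ (Fin 3)) (P : EuclideanSpace ℝ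
      (Fin 3) → ℝ), 1 < lam ∧ MeasureTheory.AEStronglyMeasurable V MeasureTheory.volume ∧ (∀ x :
      EuclideanSpace ℝ (Fin 3), x ≠ 0 → V (lam • x) = lam ^ (-(2 / 3 : ℝ)) • V x) ∧ (∀ x :
      EuclideanSpace ℝ (Fin 3), x ≠ 0 → P (lam • x) = lam ^ (-(4 / 3 : ℝ)) * P x) ∧
      MeasureTheory.LocallyIntegrableOn (fun x => ‖V x‖ ^ 2) {x : EuclideanSpace ℝ (Fin 3) | x ≠ 0}
      MeasureTheory.volume ∧ MeasureTheory.LocallyIntegrableOn P {x : EuclideanSpace ℝ (Fin 3) | x ≠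
      0} MeasureTheory.volume ∧ MeasureTheory.LocallyIntegrableOn (fun x => ‖V x‖ ^ 3) {x :
      EuclideanSpace ℝ (Fin 3) | x ≠ 0} MeasureTheory.volume ∧ MeasureTheory.LocallyIntegrableOn
      (fun x => |P x| ^ (3 / 2 : ℝ)) {x : EuclideanSpace ℝ (Fin 3) | x ≠ 0} MeasureTheory.volume ∧
      (∀ φ : EuclideanSpace ℝ (Fin 3) → EuclideanSpace ℝ (Fin 3),
      Literature.Analysis.FunctionSpaces.IsTestFunctionOn ⟨{x : EuclideanSpace ℝ (Fin 3) | x ≠ 0},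
      isOpen_ne⟩ φ → ∫ x, (inner ℝ (V x) (fderiv ℝ φ x (V x)) + P x *
      Literature.Analysis.FluidPDE.VectorCalculus.divergence φ x) = 0) ∧ (∀ θ : EuclideanSpace ℝ
      (Fin 3) → ℝ, Literature.Analysis.FunctionSpaces.IsTestFunctionOn ⟨{x : EuclideanSpace ℝ (Fin
      3) | x ≠ 0}, isOpen_ne⟩ θ → ∫ x, inner ℝ (V x) (gradient θ x) = 0) ∧ (∀ η : EuclideanSpace ℝ
      (Fin 3) → ℝ, Literature.Analysis.FunctionSpaces.IsTestFunctionOn ⟨{x : EuclideanSpace ℝ (Fin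
      3) | x ≠ 0}, isOpen_ne⟩ η → ∫ x, (‖V x‖ ^ 2 / 2 + P x) * inner ℝ (V x) (gradient η x) = 0) ∧
      (∀ᵐ x ∂MeasureTheory.volume, ‖V x‖ ^ 2 / 2 + P x ≤ 0) ∧ (∃ M : ℝ, ∀ᵐ x
      ∂(MeasureTheory.volume.restrict {x : EuclideanSpace ℝ (Fin 3) | 1 < ‖x‖ ∧ ‖x‖ < lam}), -M ≤ ‖V
      x‖ ^ 2 / 2 + P x) ∧ MeasureTheory.IntegrableOn (fun x => (‖V x‖ ^ 2 / 2 + P x) * (inner ℝ (V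
      x) x / ‖x‖ ^ 2)) {x : EuclideanSpace ℝ (Fin 3) | 1 < ‖x‖ ∧ ‖x‖ < lam} MeasureTheory.volume ∧
      (∫ x in {x : EuclideanSpace ℝ (Fin 3) | 1 < ‖x‖ ∧ ‖x‖ < lam}, (‖V x‖ ^ 2 / 2 + P x) * (inner ℝ
      (V x) x / ‖x‖ ^ 2)) < 0) :
    Summit.AnomalousDissipation.AnomalousDissipation.Theses.PointSink.PointFluxCone := by
  obtain ⟨lam, V, P, hlam, hV, hVss, hPss, hV2, hPloc, _hV3, _hP32, hEuler, hDiv, _hEnergy, _hSuction,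
    _hHead, hFluxInt, hFluxNeg⟩ := h
  exact ⟨lam, V, P, hlam, hV, hVss, hPss, hV2, hPloc, hEuler, hDiv, hFluxInt, hFluxNeg.ne⟩

/-! ## Composition -/

/-- **The line closes the crux modulo its two registered stubs.** The crux's hypothesis `PointFluxCone`
is a theorem of the tree (`Theorems.PointFluxCone_of`) and is discarded; the conclusion is
`CascadeSoliton`'s body verbatim, supplied by `stub_fedDesingularisation stub_suctionFeederCone`. -/
theorem ConeDesingularisation_of :
    Summit.AnomalousDissipation.AnomalousDissipation.Theses.PointSink.ConeDesingularisation :=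
  fun _ => stub_fedDesingularisation stub_suctionFeederCone

end Summit.AnomalousDissipation.AnomalousDissipation.Cruxes.ConeDesingularisation.SuctionFeeder

end
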